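import Literature.NumberTheory.Automorphic.Liu2021.LemD1ItemAtV2IsoOfLineTransport              -- (CM-a): `areIsomorphicRep_theta_of_lineTransportSplitting_eq_prodUnique₂` (rank-≥2 isometry-transport plumbing, Θ-currency)
import Literature.NumberTheory.GelbartRogawski1991.LocalLineIsometryNaturalityHolds             -- ★ S6a-holds `lineTransportSplitting_lineTransportSection_congrW_undoubledSplittings_holds`
import Literature.NumberTheory.Automorphic.Liu2021.Def411WeilCarriersTripleSeparation          -- ★ `localCharOfCenter_theta_eq`
import Literature.NumberTheory.GelbartRogawski1991.CMSplittingCharLocalMu                      -- ★ `localMu`, `norm_localMu`, `continuous_localMu`, `localMu_toLocalRing_eq_one_iff`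
import Literature.RepresentationTheory.HarrisKudlaSweet1996.SplittingCharactersCM                -- ★ `exists_isSplittingChar_hasUnitaryArchType`
import HarnessLib

/-!
# Crux `HLiu418` — P5 letter L4-if, ROAD v4 link (CM): the CLASS MOVE of the θ-package local factor along two lines of the same local class

F0∕P5, cell `hodgecm-mathlib`, crux item `stmt-HodgeConjecture-24832` (`HLiu418`); A-p12 (g18) on A-p18 (g24)'s ROAD CARD v4 §3 deal (CM-b)
(2026-09-01T01:05:31Z).  PROOF lane (theorems only; no `def`, no instance, no notation, no `sorry`); `--supports stmt-HodgeConjecture-24832`.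
HONEST LABEL: HC_CM is proved only modulo the printed citations (the 2 remaining named inputs hLiu418, h413) until rung 0 closes; this file proves NO
letter — it is plumbing for the assembler of the last local letter L4-if `Liu2021.LemD1RankTwoCMLetters.LemD1_4IfAsPrintedNonsplitCM₂` of #74.

THE MATHEMATICS (one paragraph).  Fix a CM field `L` (`F = L⁺`, `c`, `δ = imagUnit L`), a real non-zero frame `dV : Fin N → L` (`N ≥ 2`), a splitting
character `θ`, a centre character `χ`, a finite place `v` of `L⁺` and two lines `a₁, a₂ ∈ L⁺ˣ` IN THE SAME LOCAL CLASS at `v`: `a₂⁻¹δ = x xᶜ a₁⁻¹δ` for a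
unit `x` of `L ⊗ L⁺_v` (`hx`).  In the common δ-model `LocalMp L⁺ N T_V v` of the two pair models (B-p13's `e′_a` transport ★ `lineTransportSection`),
the lift `M_x` of the isometry `γ_x` ([MoeglinVignerasWaldspurger1987, Chap. 2 II.1]) carries the `θ`-attached CM section on the line `a₁` to the one on
the line `a₂` — this is S6a, HYPOTHESIS-FREE at every finite place (★ `lineTransportSplitting_lineTransportSection_congrW_undoubledSplittings_holds`:
Kudla's rigidity [Kudla1994, §3 Thm. 3.1] + the undoubling commutes with `Ad(M_x)`).  Hence `M_x⁻¹` is a `U(V)(L⁺_v)`-equivariant identification of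
the two carriers, the Step-3 characters `χ_v ∘ θ_a` agree on `E_v¹` for the two lines (★ `localCharOfCenter_theta_eq`: the centre character read through
either line is `χ ∘ det ∘ inclPlace v`), and the rank-`≥ 2` isometry-transport plumbing ★ (CM-a) `areIsomorphicRep_theta_of_lineTransportSplitting_eq_prodUnique₂`
(through ★ (r1) `areIsomorphicRep_localType₂_iff_quot`) yields the isomorphism of the θ-package LOCAL FACTORS in the Θ-currency:
**`Θ_pU(θ, a₂) ≅ Θ_pU(θ, a₁)`** as representations of `U(diag dV)(L⁺_v)`, `pU := Equiv.prodUnique (Fin N) (Fin 1)`.  The Step-2 character `μ` the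
indexed family carries is pure bookkeeping here (absent from the conclusion); it is instantiated inside the proof with ★ `localMu` of a unitary splitting
character (★ `exists_isSplittingChar_hasUnitaryArchType`), so the head is `μ`-free.  At `N = 2` this is link (ii) of ROAD v4 §2 (the witness `x` there
comes from ★ (C5) `sameClass_epsLine_neg_det_mul` and `(−D)a/(−a₀) = (aD)²`).

* §1 `chi_localIndexedFamilyAtV₂_eq_of_eq` — on the rank-`≥ 2` indexed family, members with the same GLOBAL centre character `χ` have the same Step-3
  character, whatever their lines (★ `localCharOfCenter_theta_eq`);
* §2 HEAD `areIsomorphicRep_theta_cmPackage_classMove` — the class move, `μ`-free, family-free (explicit packages `congrW … pU … (undoubledSplittings … θ …) …`).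

References: [MoeglinVignerasWaldspurger1987] Chap. 2 II.1 (A)–(B), Chap. 3 I.1–I.3, IV.4; [Kudla1994] §3 Thm. 3.1; [GelbartRogawski1991] §3.1 Prop. 3.1.1 p. 455,
Remark p. 457; [HarrisKudlaSweet1996] §1; [Liu2021] App. D §D.1 Steps 1–3 (l. 5217–5221), Lemma D.1 (4) (l. 5235), proof l. 5249–5255; [TateThesis1967] §3.2 Lemma 3.2.1.
-/

set_option autoImplicit false
-- the mandated namespace repeats `HodgeConjecture.HodgeConjecture`, as in every `Theorems/*.lean` of this sub-problem
set_option linter.dupNamespace false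

noncomputable section

open NumberField IsDedekindDomain Matrix MeasureTheory
open scoped MatrixGroups Kronecker
open Literature.NumberTheory.Automorphic Literature.NumberTheory.Automorphic.UnitaryGroup
open Literature.NumberTheory.GelbartRogawski1991 Literature.NumberTheory.GelbartRogawski1991.UnitaryDualPair
open Literature.NumberTheory.GelbartRogawski1991.UnitaryDualPair.LocalSplitting Literature.NumberTheory.GelbartRogawski1991.UnitaryDualPair.WeilCoinv
open Literature.NumberTheory.GelbartRogawski1991.GRConstruction
open Literature.NumberTheory.Automorphic.IdeleClassGroup
open Literature.NumberTheory.Automorphic.Liu2021 Literature.NumberTheory.Automorphic.Liu2021.Def411WeilCarriers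
open Literature.NumberTheory.Automorphic.Liu2021.Def411WeilCarriersDoubling
open Literature.RepresentationTheory Literature.RepresentationTheory.HeisenbergGroup Literature.RepresentationTheory.Liu2021
open Literature.RepresentationTheory.MoeglinVignerasWaldspurger1987
open Literature.NumberTheory.GaloisRepresentations Literature.RepresentationTheory.HarrisKudlaSweet1996

namespace Summit.HodgeConjecture.HodgeConjecture.Cruxes.HLiu418.F0P5LemD14IfClassMove

/-! ## §1 Same global centre character ⇒ same Step-3 character, whatever the lines -/

section Chi

variable (F E : Type) [Field F] [NumberField F] [Field E] [NumberField E] [Algebra F E]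
  (c : E ≃ₐ[F] E) (N : ℕ) {n : ℕ} (e : Fin N × Fin 1 ≃ Fin n)
  (JV : Matrix (Fin N) (Fin N) E) {TV : Matrix (Fin N) (Fin N) F}
  [Algebra.IsQuadraticExtension F E] {δ : E} (hcδ : c δ = -δ) (hδ : δ ≠ 0) {d : F} (hd : δ * δ = algebraMap F E d)

/-- **Members of the rank-`≥ 2` indexed family with the SAME global centre character have the SAME Step-3 character**, whatever their lines `⟨a_i⟩`,
`⟨a_j⟩`: `χ_v ∘ θ_(a_j) = χ_v ∘ θ_(a_i)` on `E_v¹` (★ `localCharOfCenter_theta_eq`: the local centre character read through either line is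
`χ ∘ det ∘ inclPlace v`). [cite: TateThesis1967, §3.2 Lemma 3.2.1] [cite: Liu2021, App. D §D.1 Step 3 (l. 5221)] -/
theorem chi_localIndexedFamilyAtV₂_eq_of_eq (hV : TV.IsSymm) (hVd : IsUnit TV.det)
    (hJV : JV = TV.map (algebraMap F E))
    (hn : 2 ≤ n) {ι : Type} (aOf : ι → Fˣ) (χOf : ι → Chi F E c)
    (𝓢Of : ∀ i, LocalSplitting.FinLocalSplittings F E c n hcδ hδ hd (UnitaryDualPair.gram F e TV (TW F (aOf i))) (isSymm_gram F e hV (isSymm_TW F (aOf i)))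
      (reindex_kronecker_eq_gram_map F E e hJV (JW_eq F E (aOf i))))
    (μOf : ι → ∀ v : HeightOneSpectrum (𝓞 F), (LocalRing E v)ˣ →* ℂˣ) (hμn : ∀ i v x, ‖((μOf i v x : ℂˣ) : ℂ)‖ = 1)
    (hμc : ∀ i v, Continuous fun x => ((μOf i v x : ℂˣ) : ℂ))
    (hμF : ∀ (i : ι) (v : HeightOneSpectrum (𝓞 F)) (t : (v.adicCompletion F)ˣ),
      μOf i v (Units.map (algebraMap (v.adicCompletion F) (LocalRing E v)).toMonoidHom t) = 1 ↔
        ∃ x : (LocalRing E v)ˣ, (x : LocalRing E v) * conjLocal E c v x = algebraMap (v.adicCompletion F) (LocalRing E v) t)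
    (v : HeightOneSpectrum (𝓞 F)) (i j : ι) (hχ : χOf j = χOf i) :
    (localIndexedFamilyAtV₂ F E c N e JV hcδ hδ hd hV hVd hJV hn aOf χOf 𝓢Of μOf hμn hμc hμF v).chi j =
      (localIndexedFamilyAtV₂ F E c N e JV hcδ hδ hd hV hVd hJV hn aOf χOf 𝓢Of μOf hμn hμc hμF v).chi i := by
  refine Subtype.ext (MonoidHom.ext fun z => ?_)
  -- by construction `chi t = chiOf … (JW a_t) (localCharOfCenter … (χOf t).1 v) …`, whose character is `χ_{t,v} ∘ θ_{a_t}`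
  change localCharOfCenter F E c (JW F E (aOf j)) (JW_apply_ne_zero F E (aOf j)) (χOf j).1 v
      (LemD1OfPlace.theta E v c N JV hcδ hδ _ (transpose_map_conj_JV F E c N JV hV hJV) (det_JV_ne_zero F E N JV hVd hJV)
        (JW F E (aOf j)) z) =
    localCharOfCenter F E c (JW F E (aOf i)) (JW_apply_ne_zero F E (aOf i)) (χOf i).1 v
      (LemD1OfPlace.theta E v c N JV hcδ hδ _ (transpose_map_conj_JV F E c N JV hV hJV) (det_JV_ne_zero F E N JV hVd hJV)
        (JW F E (aOf i)) z)
  rw [hχ]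
  exact localCharOfCenter_theta_eq F E c N JV hcδ hδ _ (transpose_map_conj_JV F E c N JV hV hJV) (det_JV_ne_zero F E N JV hVd hJV)
    v (JW F E (aOf j)) (JW F E (aOf i)) (JW_apply_ne_zero F E (aOf j)) (JW_apply_ne_zero F E (aOf i)) (χOf i).1 z

end Chi

/-! ## §2 HEAD: the class move of the θ-package local factor (μ-free, family-free) -/

section ClassMove

variable (L : Type) [Field L] [NumberField L] [IsCMField L] (v : HeightOneSpectrum (𝓞 ↥(maximalRealSubfield L))) {N : ℕ}
  (dV : Fin N → L) (hdV : ∀ i, IsCMField.complexConj L (dV i) = dV i) (hdV0 : ∀ i, dV i ≠ 0)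
  (θ : HeckeCharacter L) (hθ : IsSplittingChar L 1 θ)

set_option synthInstance.maxHeartbeats 400000 in
set_option maxHeartbeats 8000000 in
/-- **(CM) «CLASS MOVE» — `Θ_pU(θ, a₂) ≅ Θ_pU(θ, a₁)` FOR TWO LINES OF THE SAME LOCAL CLASS.**  For a CM field `L`, a real non-zero frame
`dV : Fin N → L` (`N ≥ 2`), a splitting character `θ` (`IsSplittingChar L 1 θ`), a centre character `χ`, lines `a₁ a₂ ∈ L⁺ˣ`, a finite place `v` of `L⁺`
and a unit `x` of `L ⊗ L⁺_v` with `a₂⁻¹δ = x xᶜ a₁⁻¹δ` (`hx`, the class witness): the θ-package LOCAL FACTORS of the letter's packages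
`congrW … pU … (undoubledSplittings … pU … θ …) …` at the lines `a₂`, `a₁`, read in the Θ-currency of ★ (r1) `areIsomorphicRep_localType₂_iff_quot` with
the centre characters `ξ_(a_t) := localCharOfCenter L⁺ L c (JW a_t) _ χ.1 v`, are isomorphic as representations of `U(diag dV)(L⁺_v)`.  Proof: ★ (CM-a)
`areIsomorphicRep_theta_of_lineTransportSplitting_eq_prodUnique₂` on the two-member family `![a₁, a₂]` (μ-bookkeeping from a unitary splitting character,
★ `exists_isSplittingChar_hasUnitaryArchType`), `hsec` := ★ S6a-holds, `hχ` := §1.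
[cite: MoeglinVignerasWaldspurger1987, Chap. 3 I.1–I.3, IV.4] [cite: Kudla1994, §3 Thm 3.1] [cite: Liu2021, App. D Lemma D.1 (4) (l. 5235), proof l. 5249–5255] -/
theorem areIsomorphicRep_theta_cmPackage_classMove (hN : 2 ≤ N) (χ : Chi (↥(maximalRealSubfield L)) L (IsCMField.complexConj L))
    (a₁ a₂ : (↥(maximalRealSubfield L))ˣ) (x : (LocalRing L v)ˣ)
    (hx : algebraMap L (LocalRing L v) (algebraMap (↥(maximalRealSubfield L)) L (↑a₂⁻¹ : ↥(maximalRealSubfield L)) * imagUnit L) =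
      (x : LocalRing L v) * conjLocal L (IsCMField.complexConj L) v x *
        algebraMap L (LocalRing L v) (algebraMap (↥(maximalRealSubfield L)) L (↑a₁⁻¹ : ↥(maximalRealSubfield L)) * imagUnit L)) :
    AreIsomorphicRep
      (show Representation ℂ (localPi L (IsCMField.complexConj L) N (Matrix.diagonal dV) v) _ from
        (TwistedCoinv.rep (localCharOfCenter (↥(maximalRealSubfield L)) L (IsCMField.complexConj L) (JW (↥(maximalRealSubfield L)) L a₂) (JW_apply_ne_zero (↥(maximalRealSubfield L)) L a₂) χ.1 v)
          ((congrW L (Equiv.prodUnique (Fin N) (Fin 1)) dV hdV (lineW L (TW (↥(maximalRealSubfield L)) a₂)) (complexConj_lineW L (TW (↥(maximalRealSubfield L)) a₂))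
            (realDiagonal_lineW L (TW (↥(maximalRealSubfield L)) a₂)) (diagonal_lineW L (TW (↥(maximalRealSubfield L)) a₂) (JW_eq (↥(maximalRealSubfield L)) L a₂))
            (undoubledSplittings L (Equiv.prodUnique (Fin N) (Fin 1)) dV hdV hdV0 (lineW L (TW (↥(maximalRealSubfield L)) a₂)) (complexConj_lineW L (TW (↥(maximalRealSubfield L)) a₂))
              (lineW_ne_zero L (TW (↥(maximalRealSubfield L)) a₂) (isUnit_det_TW (↥(maximalRealSubfield L)) a₂)) θ (borelPlaceMeasure L)
              (cmFinLocalFamily L (Equiv.prodUnique (Fin N) (Fin 1)) dV hdV hdV0 (lineW L (TW (↥(maximalRealSubfield L)) a₂)) (complexConj_lineW L (TW (↥(maximalRealSubfield L)) a₂))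
                (lineW_ne_zero L (TW (↥(maximalRealSubfield L)) a₂) (isUnit_det_TW (↥(maximalRealSubfield L)) a₂)) θ hθ (borelPlaceMeasure L)))
            (isSymm_TW (↥(maximalRealSubfield L)) a₂) (JW_eq (↥(maximalRealSubfield L)) L a₂)).omegaLoc v)
          (commute_omegaLoc_localCenter (↥(maximalRealSubfield L)) L (IsCMField.complexConj L) N (Equiv.prodUnique (Fin N) (Fin 1)) (Matrix.diagonal dV) (JW (↥(maximalRealSubfield L)) L a₂)
            (complexConj_imagUnit L) (imagUnit_ne_zero L) (imagUnit_mul_self L) (realDiagonal_isSymm L dV hdV) (isSymm_TW (↥(maximalRealSubfield L)) a₂)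
            (realDiagonal_map L dV hdV).symm (JW_eq (↥(maximalRealSubfield L)) L a₂) (JW_apply_ne_zero (↥(maximalRealSubfield L)) L a₂)
            (congrW L (Equiv.prodUnique (Fin N) (Fin 1)) dV hdV (lineW L (TW (↥(maximalRealSubfield L)) a₂)) (complexConj_lineW L (TW (↥(maximalRealSubfield L)) a₂))
            (realDiagonal_lineW L (TW (↥(maximalRealSubfield L)) a₂)) (diagonal_lineW L (TW (↥(maximalRealSubfield L)) a₂) (JW_eq (↥(maximalRealSubfield L)) L a₂))
            (undoubledSplittings L (Equiv.prodUnique (Fin N) (Fin 1)) dV hdV hdV0 (lineW L (TW (↥(maximalRealSubfield L)) a₂)) (complexConj_lineW L (TW (↥(maximalRealSubfield L)) a₂))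
              (lineW_ne_zero L (TW (↥(maximalRealSubfield L)) a₂) (isUnit_det_TW (↥(maximalRealSubfield L)) a₂)) θ (borelPlaceMeasure L)
              (cmFinLocalFamily L (Equiv.prodUnique (Fin N) (Fin 1)) dV hdV hdV0 (lineW L (TW (↥(maximalRealSubfield L)) a₂)) (complexConj_lineW L (TW (↥(maximalRealSubfield L)) a₂))
                (lineW_ne_zero L (TW (↥(maximalRealSubfield L)) a₂) (isUnit_det_TW (↥(maximalRealSubfield L)) a₂)) θ hθ (borelPlaceMeasure L)))
            (isSymm_TW (↥(maximalRealSubfield L)) a₂) (JW_eq (↥(maximalRealSubfield L)) L a₂)) v)).comp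
          (localLineInl L (IsCMField.complexConj L) N (Equiv.prodUnique (Fin N) (Fin 1)) (Matrix.diagonal dV) (JW (↥(maximalRealSubfield L)) L a₂) v))
      (show Representation ℂ (localPi L (IsCMField.complexConj L) N (Matrix.diagonal dV) v) _ from
        (TwistedCoinv.rep (localCharOfCenter (↥(maximalRealSubfield L)) L (IsCMField.complexConj L) (JW (↥(maximalRealSubfield L)) L a₁) (JW_apply_ne_zero (↥(maximalRealSubfield L)) L a₁) χ.1 v)
          ((congrW L (Equiv.prodUnique (Fin N) (Fin 1)) dV hdV (lineW L (TW (↥(maximalRealSubfield L)) a₁)) (complexConj_lineW L (TW (↥(maximalRealSubfield L)) a₁))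
            (realDiagonal_lineW L (TW (↥(maximalRealSubfield L)) a₁)) (diagonal_lineW L (TW (↥(maximalRealSubfield L)) a₁) (JW_eq (↥(maximalRealSubfield L)) L a₁))
            (undoubledSplittings L (Equiv.prodUnique (Fin N) (Fin 1)) dV hdV hdV0 (lineW L (TW (↥(maximalRealSubfield L)) a₁)) (complexConj_lineW L (TW (↥(maximalRealSubfield L)) a₁))
              (lineW_ne_zero L (TW (↥(maximalRealSubfield L)) a₁) (isUnit_det_TW (↥(maximalRealSubfield L)) a₁)) θ (borelPlaceMeasure L)
              (cmFinLocalFamily L (Equiv.prodUnique (Fin N) (Fin 1)) dV hdV hdV0 (lineW L (TW (↥(maximalRealSubfield L)) a₁)) (complexConj_lineW L (TW (↥(maximalRealSubfield L)) a₁))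
                (lineW_ne_zero L (TW (↥(maximalRealSubfield L)) a₁) (isUnit_det_TW (↥(maximalRealSubfield L)) a₁)) θ hθ (borelPlaceMeasure L)))
            (isSymm_TW (↥(maximalRealSubfield L)) a₁) (JW_eq (↥(maximalRealSubfield L)) L a₁)).omegaLoc v)
          (commute_omegaLoc_localCenter (↥(maximalRealSubfield L)) L (IsCMField.complexConj L) N (Equiv.prodUnique (Fin N) (Fin 1)) (Matrix.diagonal dV) (JW (↥(maximalRealSubfield L)) L a₁)
            (complexConj_imagUnit L) (imagUnit_ne_zero L) (imagUnit_mul_self L) (realDiagonal_isSymm L dV hdV) (isSymm_TW (↥(maximalRealSubfield L)) a₁)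
            (realDiagonal_map L dV hdV).symm (JW_eq (↥(maximalRealSubfield L)) L a₁) (JW_apply_ne_zero (↥(maximalRealSubfield L)) L a₁)
            (congrW L (Equiv.prodUnique (Fin N) (Fin 1)) dV hdV (lineW L (TW (↥(maximalRealSubfield L)) a₁)) (complexConj_lineW L (TW (↥(maximalRealSubfield L)) a₁))
            (realDiagonal_lineW L (TW (↥(maximalRealSubfield L)) a₁)) (diagonal_lineW L (TW (↥(maximalRealSubfield L)) a₁) (JW_eq (↥(maximalRealSubfield L)) L a₁))
            (undoubledSplittings L (Equiv.prodUnique (Fin N) (Fin 1)) dV hdV hdV0 (lineW L (TW (↥(maximalRealSubfield L)) a₁)) (complexConj_lineW L (TW (↥(maximalRealSubfield L)) a₁))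
              (lineW_ne_zero L (TW (↥(maximalRealSubfield L)) a₁) (isUnit_det_TW (↥(maximalRealSubfield L)) a₁)) θ (borelPlaceMeasure L)
              (cmFinLocalFamily L (Equiv.prodUnique (Fin N) (Fin 1)) dV hdV hdV0 (lineW L (TW (↥(maximalRealSubfield L)) a₁)) (complexConj_lineW L (TW (↥(maximalRealSubfield L)) a₁))
                (lineW_ne_zero L (TW (↥(maximalRealSubfield L)) a₁) (isUnit_det_TW (↥(maximalRealSubfield L)) a₁)) θ hθ (borelPlaceMeasure L)))
            (isSymm_TW (↥(maximalRealSubfield L)) a₁) (JW_eq (↥(maximalRealSubfield L)) L a₁)) v)).comp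
          (localLineInl L (IsCMField.complexConj L) N (Equiv.prodUnique (Fin N) (Fin 1)) (Matrix.diagonal dV) (JW (↥(maximalRealSubfield L)) L a₁) v)) := by
  -- μ-bookkeeping: any unitary splitting character of weight `1` (absent from the conclusion)
  obtain ⟨χ₀, hχ₀u, hχ₀s, -⟩ := exists_isSplittingChar_hasUnitaryArchType L 1 (fun _ => 1) (fun _ => by rw [Nat.cast_one])
  exact areIsomorphicRep_theta_of_lineTransportSplitting_eq_prodUnique₂ (↥(maximalRealSubfield L)) L (IsCMField.complexConj L) N
    (Matrix.diagonal dV) (complexConj_imagUnit L) (imagUnit_ne_zero L) (imagUnit_mul_self L) (realDiagonal_isSymm L dV hdV)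
    (isUnit_det_realDiagonal L dV hdV hdV0) (realDiagonal_map L dV hdV).symm hN (ι := Fin 2) ![a₁, a₂] (fun _ => χ)
    (Fin.cons (α := fun i : Fin 2 => LocalSplitting.FinLocalSplittings (↥(maximalRealSubfield L)) L (IsCMField.complexConj L) N
        (complexConj_imagUnit L) (imagUnit_ne_zero L) (imagUnit_mul_self L)
        (UnitaryDualPair.gram (↥(maximalRealSubfield L)) (Equiv.prodUnique (Fin N) (Fin 1)) (realDiagonal L dV hdV) (TW (↥(maximalRealSubfield L)) (![a₁, a₂] i)))
        (isSymm_gram (↥(maximalRealSubfield L)) (Equiv.prodUnique (Fin N) (Fin 1)) (realDiagonal_isSymm L dV hdV) (isSymm_TW (↥(maximalRealSubfield L)) (![a₁, a₂] i)))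
        (reindex_kronecker_eq_gram_map (↥(maximalRealSubfield L)) L (Equiv.prodUnique (Fin N) (Fin 1)) (realDiagonal_map L dV hdV).symm
          (JW_eq (↥(maximalRealSubfield L)) L (![a₁, a₂] i))))
      (congrW L (Equiv.prodUnique (Fin N) (Fin 1)) dV hdV (lineW L (TW (↥(maximalRealSubfield L)) a₁)) (complexConj_lineW L (TW (↥(maximalRealSubfield L)) a₁))
            (realDiagonal_lineW L (TW (↥(maximalRealSubfield L)) a₁)) (diagonal_lineW L (TW (↥(maximalRealSubfield L)) a₁) (JW_eq (↥(maximalRealSubfield L)) L a₁))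
            (undoubledSplittings L (Equiv.prodUnique (Fin N) (Fin 1)) dV hdV hdV0 (lineW L (TW (↥(maximalRealSubfield L)) a₁)) (complexConj_lineW L (TW (↥(maximalRealSubfield L)) a₁))
              (lineW_ne_zero L (TW (↥(maximalRealSubfield L)) a₁) (isUnit_det_TW (↥(maximalRealSubfield L)) a₁)) θ (borelPlaceMeasure L)
              (cmFinLocalFamily L (Equiv.prodUnique (Fin N) (Fin 1)) dV hdV hdV0 (lineW L (TW (↥(maximalRealSubfield L)) a₁)) (complexConj_lineW L (TW (↥(maximalRealSubfield L)) a₁))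
                (lineW_ne_zero L (TW (↥(maximalRealSubfield L)) a₁) (isUnit_det_TW (↥(maximalRealSubfield L)) a₁)) θ hθ (borelPlaceMeasure L)))
            (isSymm_TW (↥(maximalRealSubfield L)) a₁) (JW_eq (↥(maximalRealSubfield L)) L a₁))
      (Fin.cons
        (congrW L (Equiv.prodUnique (Fin N) (Fin 1)) dV hdV (lineW L (TW (↥(maximalRealSubfield L)) a₂)) (complexConj_lineW L (TW (↥(maximalRealSubfield L)) a₂))
            (realDiagonal_lineW L (TW (↥(maximalRealSubfield L)) a₂)) (diagonal_lineW L (TW (↥(maximalRealSubfield L)) a₂) (JW_eq (↥(maximalRealSubfield L)) L a₂))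
            (undoubledSplittings L (Equiv.prodUnique (Fin N) (Fin 1)) dV hdV hdV0 (lineW L (TW (↥(maximalRealSubfield L)) a₂)) (complexConj_lineW L (TW (↥(maximalRealSubfield L)) a₂))
              (lineW_ne_zero L (TW (↥(maximalRealSubfield L)) a₂) (isUnit_det_TW (↥(maximalRealSubfield L)) a₂)) θ (borelPlaceMeasure L)
              (cmFinLocalFamily L (Equiv.prodUnique (Fin N) (Fin 1)) dV hdV hdV0 (lineW L (TW (↥(maximalRealSubfield L)) a₂)) (complexConj_lineW L (TW (↥(maximalRealSubfield L)) a₂))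
                (lineW_ne_zero L (TW (↥(maximalRealSubfield L)) a₂) (isUnit_det_TW (↥(maximalRealSubfield L)) a₂)) θ hθ (borelPlaceMeasure L)))
            (isSymm_TW (↥(maximalRealSubfield L)) a₂) (JW_eq (↥(maximalRealSubfield L)) L a₂))
        finZeroElim))
    (fun _ => localMu L χ₀) (fun _ w y => norm_localMu L χ₀ w hχ₀u y) (fun _ w => continuous_localMu L χ₀ w)
    (fun _ w t => localMu_toLocalRing_eq_one_iff L χ₀ w hχ₀s t) v 0 1 x hx
    (lineTransportSplitting_lineTransportSection_congrW_undoubledSplittings_holds L dV hdV hdV0 v (lt_of_lt_of_le Nat.zero_lt_two hN) θ hθ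
      a₁ a₂ x hx)
    (chi_localIndexedFamilyAtV₂_eq_of_eq (↥(maximalRealSubfield L)) L (IsCMField.complexConj L) N (Equiv.prodUnique (Fin N) (Fin 1)) (Matrix.diagonal dV)
      (complexConj_imagUnit L) (imagUnit_ne_zero L) (imagUnit_mul_self L) (realDiagonal_isSymm L dV hdV) (isUnit_det_realDiagonal L dV hdV hdV0)
      (realDiagonal_map L dV hdV).symm hN ![a₁, a₂] (fun _ => χ) _ _ _ _ _ v 0 1 rfl)

end ClassMove

end Summit.HodgeConjecture.HodgeConjecture.Cruxes.HLiu418.F0P5LemD14IfClassMove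

end
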